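import Summits.BirchSwinnertonDyer.BirchSwinnertonDyer.Theorems.ClassRecordThreeEulerHalvesAtThreeCartanCarayolJointEigen
import Literature.Algebra.Module.DeligneSerreLifting
import HarnessLib

/-!
# The Deligne–Serre package for a Hecke-stable lattice of a complex representation
# (glue for the discharge of (LIFT′) `CartanCarayol.CuspidalEigenCochainLiftPrimeToCartanPlaceAtThree`)

Theorems only; no new vocabulary, no obligation. This is the COVER-SIDE twin of the sibling's
`Literature.NumberTheory.ModularSymbols.exists_deligneSerre_lift_of_eigenvector_mod` /
`exists_isNewform0_of_eigenvector_mod` (there: `Λ = H₁(X₀(N), ℤ)` inside `S₂(Γ₀(N))^∨`, the commutative ring `𝕋_ℤ`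
given in advance), stated ABSTRACTLY so that the only print inputs left for (LIFT′) are the Eichler–Shimura
isomorphism, the freeness of `Hom_par(Γ′, ℤ)` and Jacquet–Langlands on the Cartan cover `Γ′ = ι(O₀'¹)`:

* **setting**: a free finite `ℤ`-module `M` (↦ `Hom_par,tors(Γ′, ℤ)`), a finite-dimensional complex vector space `V`
  (↦ `S₂(Γ′)`), an injective additive map `e : M → V` whose image spans `V` over `ℂ` (↦ the Eichler–Shimura period map,
  [ShimuraIATAF1971, Thm 8.4]), a family of `ℂ`-linear operators `T i` (`i ∈ P`) on `V` commuting pairwise on `P` and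
  preserving `e(M)` (↦ the Hecke operators `T_ℓ`, `ℓ ∉ S`, [ShimuraIATAF1971, Prop 3.8, § 8.3];
  `CartanCarayol.heckeOp_apply_eq_zero_of_isParabolic` for the stability of parabolic-null cochains), and a vector
  `f ∈ M ∖ 3M` with `T i (e f) ∈ e(a i • f + 3M)` for `i ∈ P` (↦ the `ZMod 3`-eigen-cochain of
  `CartanCarayol.exists_zmod_three_cochain_of_package`, lifted to `M` by the mod-`3` surjectivity of reduction);
* **conclusion** (`exists_eigenvalueOrder_of_eigenvector_mod_three`): an order `R` (a domain, module-finite over `ℤ`)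
  with an embedding `σ : R ↪ ℂ`, a place `ψ : R → ℤ/3` and elements `t i ∈ R`, and a NONZERO `v ∈ V` with
  `T i v = σ(t i) • v` and `ψ(t i) = a i mod 3` for every `i ∈ P` — a genuine complex joint eigenvector whose
  eigenvalues reduce to the given mod-`3` eigenvalues. Downstream (not here): `v` is a Hecke eigenform on `Γ′`,
  Jacquet–Langlands moves it to `Γ₀(M_f)`, and `Literature.NumberTheory.ModularSymbols.exists_maximal_ideal_over_ker`
  + `liftToGamma1` finish (LIFT′) verbatim as in `TameQuarticManinParity.modThreePeriodEigenclassLiftsToNewform_proof`.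

Mechanism: `H := ℤ[T i : i ∈ P] ⊆ End_ℂ V` is commutative (`Algebra.isMulCommutative_adjoin`); `M` becomes a faithful
`H`-module through `e` (§ 1); the tree's Deligne–Serre lemma `Literature.Algebra.Module.DeligneSerre.deligneSerre_lifting_eigenvector`
[DeligneSerre1974, Lemme 6.11] gives a minimal prime `𝔭` of `H` with `𝔭 ∩ ℤ = 0`, `ψ : H/𝔭 → ℤ/3` and `m ∈ M ∖ 0` with
annihilator `𝔭`; the `ℂ`-span of `H • e(m)` carries a joint eigenvector (`CartanCarayol.exists_joint_eigenvector_of_commute_of_set`),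
whose eigenvalue character factors through `R := H/𝔭` and is injective because `H/𝔭` is an integral domain finite over `ℤ`
(`Literature.NumberTheory.ModularSymbols.injective_ringHom_of_isIntegral_int`).

## References
* [DeligneSerre1974] P. Deligne, J.-P. Serre, *Formes modulaires de poids 1*, Ann. Sci. ÉNS 7 (1974), Lemme 6.11.
* [ShimuraIATAF1971] G. Shimura, *Introduction to the arithmetic theory of automorphic functions* (1971), Prop 3.8, Thm 8.4, § 8.3.
* [DarmonDiamondTaylor1995] H. Darmon, F. Diamond, R. Taylor, *Fermat's Last Theorem*, § 1.6 («𝕋_ℤ acts on Λ»), Lemma 4.34.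
-/

set_option linter.dupNamespace false

namespace Summit.BirchSwinnertonDyer.BirchSwinnertonDyer.Theorems.CartanCarayol

open scoped Pointwise

universe u v w

/-! ## § 1 The lattice as a faithful module over `ℤ[T i]` -/

/-- every element of `ℤ[s] ⊆ End_ℂ V` preserves a lattice `e(M)` preserved by `s`. [folklore] -/
theorem exists_apply_eq_of_mem_adjoin {M : Type u} [AddCommGroup M] {V : Type v} [AddCommGroup V] [Module ℂ V] (e : M →+ V)
    {s : Set (Module.End ℂ V)} (hs : ∀ T ∈ s, ∀ x : M, ∃ y : M, T (e x) = e y) {h : Module.End ℂ V}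
    (hh : h ∈ Algebra.adjoin ℤ s) (x : M) : ∃ y : M, h (e x) = e y := by
  induction hh using Algebra.adjoin_induction generalizing x with
  | mem T hT => exact hs T hT x
  | algebraMap n => exact ⟨n • x, by rw [Module.algebraMap_end_apply, map_zsmul]⟩
  | add g h _ _ ihg ihh =>
    obtain ⟨y, hy⟩ := ihg x
    obtain ⟨z, hz⟩ := ihh x
    exact ⟨y + z, by rw [LinearMap.add_apply, hy, hz, map_add]⟩
  | mul g h _ _ ihg ihh =>
    obtain ⟨z, hz⟩ := ihh x
    obtain ⟨y, hy⟩ := ihg z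
    exact ⟨y, by rw [Module.End.mul_apply, hz, hy]⟩

/-- an endomorphism killing a `ℂ`-spanning lattice is zero. [folklore] -/
theorem eq_zero_of_forall_apply_eq_zero {M : Type u} [AddCommGroup M] {V : Type v} [AddCommGroup V] [Module ℂ V] (e : M →+ V)
    (hspan : Submodule.span ℂ (Set.range e) = ⊤) {h : Module.End ℂ V} (h0 : ∀ x, h (e x) = 0) : h = 0 := by
  have hle : Submodule.span ℂ (Set.range ⇑e) ≤ LinearMap.ker h := Submodule.span_le.mpr (by rintro _ ⟨x, rfl⟩; exact h0 x)
  ext w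
  exact hle (hspan ▸ Submodule.mem_top)

/-- `f ∉ 3M` and `c • f ∈ 3M` force `3 ∣ c` (Bézout). [folklore] -/
theorem three_dvd_of_zsmul_eq {M : Type u} [AddCommGroup M] {f : M} (hf : ∀ u : M, f ≠ (3 : ℤ) • u) {c : ℤ} {u : M}
    (h : c • f = (3 : ℤ) • u) : (3 : ℤ) ∣ c := by
  by_contra hnd
  obtain ⟨x, y, hxy⟩ := (Int.prime_three.irreducible.coprime_iff_not_dvd).mpr hnd
  refine hf (x • f + y • u) ?_
  calc f = (x * 3 + y * c) • f := by rw [hxy, one_smul]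
    _ = (3 : ℤ) • (x • f + y • u) := by rw [add_smul, mul_comm x, mul_smul, mul_smul, h, smul_comm y (3 : ℤ) u, smul_add]

/-- membership in `(3) • M`. [folklore] -/
theorem mem_span_three_smul_top_iff {M : Type u} [AddCommGroup M] (x : M) :
    x ∈ ((Ideal.span {(3 : ℤ)} : Ideal ℤ) • (⊤ : Submodule ℤ M)) ↔ ∃ u : M, (3 : ℤ) • u = x := by
  rw [Submodule.ideal_span_singleton_smul, Submodule.mem_smul_pointwise_iff_exists]
  simp

/-! ## § 2 The package -/

open scoped IsMulCommutative in
/-- **THE DELIGNE–SERRE PACKAGE ON A HECKE-STABLE LATTICE.** A mod-`3` eigen-system `(a i)_{i ∈ P}` occurring on a vector `f ∈ M ∖ 3M` of a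
free finite `ℤ`-lattice `e : M ↪ V` spanning the finite-dimensional complex representation `V` of a commuting family `(T i)_{i ∈ P}` preserving
`e(M)` lifts: there are an order `R` (an integral domain, module-finite over `ℤ`) with an embedding `σ : R ↪ ℂ`, a place `ψ : R → ℤ/3`,
elements `t i ∈ R` and a nonzero JOINT EIGENVECTOR `v ∈ V` with `T i v = σ(t i) • v` and `ψ(t i) = a i (mod 3)` for all `i ∈ P`.
[DeligneSerre1974, Lemme 6.11] (`deligneSerre_lifting_eigenvector`) + [ShimuraIATAF1971, § 8.3] (setting) [folklore: assembly]. -/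
theorem exists_eigenvalueOrder_of_eigenvector_mod_three
    {M : Type u} [AddCommGroup M] [Module.Free ℤ M] [Module.Finite ℤ M]
    {V : Type v} [AddCommGroup V] [Module ℂ V] [FiniteDimensional ℂ V]
    {ι : Type w} (P : Set ι) (T : ι → Module.End ℂ V) (hc : ∀ i ∈ P, ∀ j ∈ P, Commute (T i) (T j))
    (e : M →+ V) (he : Function.Injective e) (hspan : Submodule.span ℂ (Set.range e) = ⊤)
    (hstab : ∀ i ∈ P, ∀ x : M, ∃ y : M, T i (e x) = e y)
    (a : ι → ℤ) (f : M) (hf : ∀ u : M, f ≠ (3 : ℤ) • u)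
    (heig : ∀ i ∈ P, ∃ u : M, T i (e f) = e (a i • f + (3 : ℤ) • u)) :
    ∃ (R : Type v) (_ : CommRing R) (_ : IsDomain R) (_ : Module.Finite ℤ R) (σ : R →+* ℂ)
      (ψ : R →+* ℤ ⧸ (Ideal.span {(3 : ℤ)} : Ideal ℤ)) (t : ι → R) (v : V),
      Function.Injective σ ∧ v ≠ 0 ∧ (∀ i ∈ P, T i v = σ (t i) • v) ∧ ∀ i ∈ P, ψ (t i) = Ideal.Quotient.mk _ (a i) := by
  classical
  -- the commutative ring `H = ℤ[T i : i ∈ P] ⊆ End_ℂ V`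
  set s : Set (Module.End ℂ V) := T '' P with hs
  have hcomm : ∀ x ∈ s, ∀ y ∈ s, x * y = y * x := by
    rintro _ ⟨i, hi, rfl⟩ _ ⟨j, hj, rfl⟩
    exact (hc i hi j hj).eq
  haveI hmc : IsMulCommutative (Algebra.adjoin ℤ s) := Algebra.isMulCommutative_adjoin ℤ hcomm
  set H : Subalgebra ℤ (Module.End ℂ V) := Algebra.adjoin ℤ s with hH
  -- `M` is an `H`-module through `e`
  have hstabH : ∀ (h : H) (x : M), ∃ y : M, (h : Module.End ℂ V) (e x) = e y := fun h x ↦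
    exists_apply_eq_of_mem_adjoin e (by rintro _ ⟨i, hi, rfl⟩ x; exact hstab i hi x) h.2 x
  letI : SMul H M := ⟨fun h x ↦ (hstabH h x).choose⟩
  have hsm : ∀ (h : H) (x : M), e (h • x) = (h : Module.End ℂ V) (e x) := fun h x ↦ (hstabH h x).choose_spec.symm
  letI : Module H M := Module.ofMinimalAxioms
    (fun h x y ↦ he (by rw [hsm, map_add, map_add, map_add, hsm, hsm]))
    (fun g h x ↦ he (by rw [hsm, map_add, hsm, hsm, Subalgebra.coe_add, LinearMap.add_apply]))
    (fun g h x ↦ he (by rw [hsm, hsm, hsm, Subalgebra.coe_mul, Module.End.mul_apply]))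
    (fun x ↦ he (by rw [hsm, Subalgebra.coe_one, Module.End.one_apply]))
  haveI : IsScalarTower ℤ H M :=
    ⟨fun n h x ↦ he (by rw [hsm, map_zsmul, hsm, Subalgebra.coe_smul, LinearMap.smul_apply])⟩
  have hfaith : Module.annihilator H M = ⊥ := by
    rw [eq_bot_iff]
    intro h hh
    rw [Module.mem_annihilator] at hh
    have h0 : (h : Module.End ℂ V) = 0 := eq_zero_of_forall_apply_eq_zero e hspan fun x ↦ by rw [← hsm, hh, map_zero]
    rw [Ideal.mem_bot]
    exact Subtype.ext h0
  -- the mod-3 eigenvector hypothesis in the Deligne–Serre format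
  set 𝔪 : Ideal ℤ := Ideal.span {(3 : ℤ)} with h𝔪
  haveI : 𝔪.IsMaximal := PrincipalIdealRing.isMaximal_of_irreducible Int.prime_three.irreducible
  set 𝒯 : Set H := Subtype.val ⁻¹' s with h𝒯
  have h𝒯top : Algebra.adjoin ℤ 𝒯 = ⊤ := Algebra.adjoin_adjoin_coe_preimage
  have hf' : f ∉ (𝔪 • ⊤ : Submodule ℤ M) := fun hmem ↦ by
    obtain ⟨u, hu⟩ := (mem_span_three_smul_top_iff f).mp hmem
    exact hf u hu.symm
  let a' : H → ℤ := fun h ↦ if hh : (h : Module.End ℂ V) ∈ s then a hh.choose else 0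
  -- consistency: the mod-3 eigenvalue of `T i` on `f` does not depend on `i`
  have hcons : ∀ i ∈ P, ∀ j ∈ P, T i = T j → (3 : ℤ) ∣ a j - a i := fun i hi j hj hij ↦ by
    obtain ⟨u, hu⟩ := heig i hi
    obtain ⟨u', hu'⟩ := heig j hj
    rw [hij, hu'] at hu
    have e1 : (a j - a i) • f = (3 : ℤ) • (u - u') := by
      rw [sub_smul, smul_sub, sub_eq_sub_iff_add_eq_add, add_comm ((3 : ℤ) • u), ← he hu, add_comm]
    exact three_dvd_of_zsmul_eq hf e1
  have heig' : ∀ h ∈ 𝒯, h • f - a' h • f ∈ (𝔪 • ⊤ : Submodule ℤ M) := fun h hh ↦ by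
    have hh' : (h : Module.End ℂ V) ∈ s := hh
    obtain ⟨hiP, hiT⟩ := hh'.choose_spec
    obtain ⟨u, hu⟩ := heig _ hiP
    rw [mem_span_three_smul_top_iff]
    refine ⟨u, ?_⟩
    have e1 : h • f = a hh'.choose • f + (3 : ℤ) • u := he (by rw [hsm]; exact (congrArg (fun F : Module.End ℂ V ↦ F (e f)) hiT).symm.trans hu)
    rw [e1, show a' h = a hh'.choose from dif_pos hh', add_sub_cancel_left]
  -- Deligne–Serre
  obtain ⟨𝔭, h𝔭min, -, -, hfin, ⟨ψ, hψ⟩, m, hm0, hann⟩ :=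
    Literature.Algebra.Module.DeligneSerre.deligneSerre_lifting_eigenvector (O := ℤ) (H := H) (M := M) hfaith 𝔪 h𝒯top hf' a' heig'
  haveI h𝔭prime : 𝔭.IsPrime := h𝔭min.1.1
  haveI : Module.Finite ℤ (H ⧸ 𝔭) := hfin
  -- the complex joint eigenvector on `W = ℂ·H·e(m)`
  set W : Submodule ℂ V := Submodule.span ℂ (Set.range fun h : H ↦ (h : Module.End ℂ V) (e m)) with hW
  have hWstab : ∀ g ∈ (Set.univ : Set H), W ≤ W.comap (g : Module.End ℂ V) := fun g _ ↦ by
    rw [hW, Submodule.span_le]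
    rintro _ ⟨h, rfl⟩
    exact Submodule.subset_span ⟨g * h, rfl⟩
  have hem0 : e m ≠ 0 := fun h0 ↦ hm0 (he (by rw [h0, map_zero]))
  have hemW : e m ∈ W := Submodule.subset_span ⟨1, by simp only; rw [Subalgebra.coe_one, Module.End.one_apply]⟩
  have hW0 : W ≠ ⊥ := fun hb ↦ hem0 (by rw [hb, Submodule.mem_bot] at hemW; exact hemW)
  obtain ⟨v, hvW, hv0, hev⟩ := exists_joint_eigenvector_of_commute_of_set (Set.univ : Set H) (fun h : H ↦ (h : Module.End ℂ V))
    (fun g _ h _ ↦ (congrArg Subtype.val (mul_comm g h) :)) W hWstab hW0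
  -- the eigenvalue character `H → ℂ`, trivial on `𝔭`
  have hev' : ∀ h : H, ∃ c : ℂ, (h : Module.End ℂ V) v = c • v := fun h ↦ hev h (Set.mem_univ h)
  choose lam hlam using hev'
  have hinj : Function.Injective fun c : ℂ ↦ c • v := smul_left_injective ℂ hv0
  have hkill : ∀ p ∈ 𝔭, (p : Module.End ℂ V) v = 0 := fun p hp ↦ by
    have hle : W ≤ LinearMap.ker (p : Module.End ℂ V) := by
      rw [hW, Submodule.span_le]
      rintro _ ⟨h, rfl⟩
      rw [SetLike.mem_coe, LinearMap.mem_ker, ← Module.End.mul_apply, ← Subalgebra.coe_mul, mul_comm, Subalgebra.coe_mul,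
        Module.End.mul_apply, ← hsm, (hann p).mpr hp, map_zero, map_zero]
    exact hle hvW
  let σ' : H →+* ℂ :=
    { toFun := lam
      map_one' := hinj (by simp only; rw [← hlam, one_smul, Subalgebra.coe_one, Module.End.one_apply])
      map_mul' := fun g h ↦ hinj (by simp only; rw [← hlam, Subalgebra.coe_mul, Module.End.mul_apply, hlam, map_smul, hlam, smul_smul, mul_comm])
      map_zero' := hinj (by simp only; rw [← hlam, zero_smul, Subalgebra.coe_zero, LinearMap.zero_apply])
      map_add' := fun g h ↦ hinj (by simp only; rw [← hlam, Subalgebra.coe_add, LinearMap.add_apply, hlam, hlam, add_smul]) }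
  have hσ'𝔭 : ∀ p ∈ 𝔭, σ' p = 0 := fun p hp ↦ by
    have h1 : lam p • v = 0 := by rw [← hlam, hkill p hp]
    exact (smul_eq_zero.mp h1).resolve_right hv0
  let σ : H ⧸ 𝔭 →+* ℂ := Ideal.Quotient.lift 𝔭 σ' hσ'𝔭
  -- assembly
  refine ⟨H ⧸ 𝔭, inferInstance, inferInstance, hfin, σ, ψ,
    fun i ↦ if hi : i ∈ P then Ideal.Quotient.mk 𝔭 ⟨T i, Algebra.subset_adjoin ⟨i, hi, rfl⟩⟩ else 0, v,
    Literature.NumberTheory.ModularSymbols.injective_ringHom_of_isIntegral_int σ, hv0, fun i hi ↦ ?_, fun i hi ↦ ?_⟩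
  · simp only [dif_pos hi]
    change (T i) v = Ideal.Quotient.lift 𝔭 σ' hσ'𝔭 (Ideal.Quotient.mk 𝔭 _) • v
    rw [Ideal.Quotient.lift_mk]
    exact hlam ⟨T i, Algebra.subset_adjoin ⟨i, hi, rfl⟩⟩
  · have hmem : (⟨T i, Algebra.subset_adjoin ⟨i, hi, rfl⟩⟩ : H) ∈ 𝒯 := ⟨i, hi, rfl⟩
    have hs' : T i ∈ s := ⟨i, hi, rfl⟩
    simp only [dif_pos hi]
    rw [hψ _ hmem, Ideal.Quotient.eq, Ideal.mem_span_singleton]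
    simp only [a', dif_pos hs']
    obtain ⟨hjP, hjT⟩ := hs'.choose_spec
    exact hcons i hi hs'.choose hjP hjT.symm
end Summit.BirchSwinnertonDyer.BirchSwinnertonDyer.Theorems.CartanCarayol
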